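import Literature.Barriers.AtomisticToContinuum.AnticontinuumLocalizationNormalFormBounds
import HarnessLib

/-!
# De Roeck–Huveneers 2015, §4.2 (interface) and §5.1 for the rotor chain: resonance cut-offs and the partition `ϑ`

`Literature/Barriers/AtomisticToContinuum/` — continuation of the normal-form files. This file
isolates, as a HYPOTHESIS STRUCTURE (not a named fact), exactly what §4 of W. De Roeck,
F. Huveneers, CPAM 68 (2015), arXiv:1305.5127 delivers to §5 — a family of smooth resonance
cut-offs `θ_x(ω)` indexed by the sites of the window, with the two properties of Proposition 2
(§4.2), the smoothness/symbol bounds and the locality that §5 uses, and the set `S(x)` — and then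
carries out §5.1 on top of it, PROVED:

* `ResonanceCutoffs m r L n₂` (data `θ`, radii `Rθ`, `RS`, sets `S(x)`; properties: symbol of order
  `0` and `0 ≤ θ ≤ 1` (the convolution definition of `θ_{x,δ,n₂}` in §4.2; "`∂ϑ_{a,x}, ∂ϑ_{a,*} ∼ δ^{-1}`"
  in §5.6), locality (§5.3), non-resonance where `θ > 0` (Prop. 2, first item), `k·∇_ω θ_x = 0` at
  single near-resonances off `S(x)` (the reduction in the proof of the second item of Prop. 2, §4.3),
  a near-resonance where `θ < 1` (§5.5, proof of Lemma 4, first claim), and `n₂` independent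
  near-resonances on `S(x)` (definition of `S_{δ,n₂}(x)`, §4.2));
* the partition of unity `ϑ_{a,x}`, `ϑ_*` of §5.1: `nearSites` (`B(a, n₃)`), `piTheta`, `nrm`
  (`𝒩 ≥ 1`, `one_le_nrm`, by the union bound `1 - ∏(1-θ) ≤ ∑θ`), `vt`, `vtStar`,
  `∑_x ϑ_{a,x} + ϑ_* = 1` (`sum_vt_add_vtStar`), `0 ≤ ϑ ≤ 1`, smoothness, symbol classes of order `0`
  (with `isDeltaSymbol_inv` for `𝒩⁻¹`), locality (`DependsOn` a ball around `a`), and the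
  qualitative facts used in §5.4–5.6: `ϑ_{a,x}(ω) ≠ 0 ⇒ θ_x(ω) > 0`, `ϑ_*(ω) ≠ 0 ⇒ θ_y(ω) < 1 ∀y`,
  and on the good set `{θ_y = 1 ∀ y ∈ B(a,n₃)}` (the complement of `W` of §5.6): `ϑ_{a,x} = [x = a]`,
  `ϑ_* = 0`, all gradients `0`.
-/

noncomputable section

open Function Set Finset Filter Metric
open scoped ContDiff BigOperators Topology

namespace Literature.Barriers.AtomisticToContinuum.HeatConduction.RotorChain

open Literature.MathematicalPhysics.KineticTheory.HeatConduction
open Literature.Analysis.Calculus Literature.Analysis.Calculus.IsDeltaSymbol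

variable {m : ℕ}

/-! ### The modes `K_r` and the hypothesis structure -/

/-- `k ∈ K_r`, `k ≠ 0`: a NONZERO mode of sup-norm `≤ r` supported in some ball of radius `r`. The
printed `K_r` ("vectors `k` such that `max_x |k_x| ≤ r` and `supp(k) ⊂ B(r)` for some ball `B(r)` of
radius `r`", §4.1) contains `0`; excluding it here is a deliberate choice (the first item of Prop. 2
is only meaningful for `k ≠ 0`, and §5.4 singles out "`k ∈ K_r, k ≠ 0`"). [cite: DeRoeckHuveneers2015, §4.1 (definition of `K_r`) and §5.4] -/
def IsKMode (r : ℕ) (k : Fin m → ℤ) : Prop :=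
  k ≠ 0 ∧ (∀ y : Fin m, |k y| ≤ r) ∧ ∃ c : Fin m, ∀ y : Fin m, r < Nat.dist c.val y.val → k y = 0

/-- A mode supported in the ball of radius `R` around `x`. [cite: DeRoeckHuveneers2015, §4.1 (`K_r(B(x, R))`)] -/
def ModeNear (x : Fin m) (R : ℕ) (k : Fin m → ℤ) : Prop := ∀ y : Fin m, R < Nat.dist x.val y.val → k y = 0

/-- **What §4 delivers to §5** — resonance cut-offs `θ_x(ω)` (`θ_{x,δ,n₂}` in the paper) for the sites
of a window, as a hypothesis structure. Fields that ARE Proposition 2 (§4.2) as printed: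
`nonres_of_pos` is its first item ("If `θ_{x,δ,n₂}(ω) > 0` then `ρ_δ(ω·k) = 0` for all `k ∈ K_r` such
that `supp(k) ⊂ B(x,4r)`"), in the strict form `|k·ω| > 2δ` that its proof (§4.3) actually gives;
`fderiv_eq_zero` is the displayed reduction in the proof of its second item (§4.3: "It is thus enough
to show that `k·∇_ω θ_x(ω) = 0` for every `k ∈ K_r` and every `ω ∉ S_{n₂}(x)` such that
`|k·ω| ≤ 2δ`"). Separate facts, NOT items of Prop. 2: `symbol`, `nonneg`, `le_one` (smoothness,
`[0,1]`-valuedness and the `δ^{-|l|}` derivative bounds of the convolution definition of `θ_{x,δ,n₂}`,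
§4.2, used in §5.6 as "`∂ϑ_{a,x}, ∂ϑ_{a,*} ∼ δ^{-1}`"); `dependsOn` (locality, §5.3: "`ϑ_{a,x}` …
only depend on variables indexed by `z` with `z ≥ a - (n₃ + 4r + n₂ r)`", here with a free radius
`Rθ`); `nearRes_of_lt_one` (§5.5, proof of Lemma 4, first claim: `θ_x(ω) < 1` gives a cluster member
`k`, `supp(k) ⊂ B(x,4r)`, with `|ω·k| ≤ L^{n₂+1}δ` — here in `B(x, RS)`, `RS ≥ 4r` in the intended
instance); `multiRes_subset` (a weakening of the definition of `S_{δ,n₂}(x)` in §4.2: a cluster of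
`n₂` members is linearly independent with supports within `C n₂ r` of `x`).
[cite: DeRoeckHuveneers2015, §4.2 Prop. 2 and definition of `S_{δ,n₂}(x)`; §4.3; §5.3; §5.5 Lemma 4] -/
structure ResonanceCutoffs (m r L n₂ : ℕ) where
  /-- the cut-offs `θ_x(δ, ω)` -/
  θ : Fin m → ℝ → (Fin m → ℝ) → ℝ
  /-- locality radius of `θ_x` (the `4r + n₂ r` of §5.3) -/
  Rθ : ℕ
  /-- radius of the multi-resonance set `S(x)` and of the near-resonant modes detected by `θ_x < 1` (`C n₂ r`) -/
  RS : ℕ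
  /-- the multi-resonance sets `S(x)` at scale `δ` -/
  multiRes : Fin m → ℝ → Set (Fin m → ℝ)
  symbol : ∀ x, IsDeltaSymbol 0 (θ x)
  nonneg : ∀ x δ w, 0 ≤ θ x δ w
  le_one : ∀ x δ w, θ x δ w ≤ 1
  dependsOn : ∀ x δ, DependsOn (θ x δ) (siteBall x Rθ)
  nonres_of_pos : ∀ δ, 0 < δ → δ ≤ 1 → ∀ x w, 0 < θ x δ w →
    ∀ k, IsKMode r k → ModeNear x (4 * r) k → 2 * δ < |modeFreq k w|
  fderiv_eq_zero : ∀ δ, 0 < δ → δ ≤ 1 → ∀ x w, w ∉ multiRes x δ →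
    ∀ k, IsKMode r k → |modeFreq k w| ≤ 2 * δ → fderiv ℝ (θ x δ) w (modeVec k) = 0
  nearRes_of_lt_one : ∀ δ, 0 < δ → δ ≤ 1 → ∀ x w, θ x δ w < 1 →
    ∃ k, IsKMode r k ∧ ModeNear x RS k ∧ |modeFreq k w| ≤ (L : ℝ) ^ (n₂ + 1) * δ
  multiRes_subset : ∀ δ, 0 < δ → δ ≤ 1 → ∀ x w, w ∈ multiRes x δ →
    ∃ ks : Fin n₂ → (Fin m → ℤ), LinearIndependent ℝ (fun j => modeVec (ks j)) ∧
      ∀ j, IsKMode r (ks j) ∧ ModeNear x RS (ks j) ∧ |modeFreq (ks j) w| ≤ (L : ℝ) ^ (n₂ + 1) * δ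

namespace ResonanceCutoffs

variable {r L n₂ : ℕ} (Θ : ResonanceCutoffs m r L n₂)

/-- The cut-offs are smooth at every scale `δ ∈ (0, 1]`. [cite: DeRoeckHuveneers2015, §4.2 ("a smooth indicator function … by means of a convolution")] -/
theorem contDiff {δ : ℝ} (hδ : 0 < δ) (hδ1 : δ ≤ 1) (x : Fin m) : ContDiff ℝ ∞ (Θ.θ x δ) :=
  (Θ.symbol x).contDiff hδ hδ1

/-- At a point where `θ_x = 1` (a maximum) the gradient vanishes. [folklore] -/
theorem fderiv_eq_zero_of_eq_one {δ : ℝ} (x : Fin m) {w : Fin m → ℝ}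
    (h : Θ.θ x δ w = 1) : fderiv ℝ (Θ.θ x δ) w = 0 := by
  refine IsLocalMax.fderiv_eq_zero ?_
  filter_upwards with w'
  rw [h]; exact Θ.le_one x δ w'

end ResonanceCutoffs

/-! ### Finite products of symbols and of local functions -/

/-- Finite products of symbols of order `0` are symbols of order `0`. [folklore] -/
theorem isDeltaSymbol_prod {ι E : Type*} [NormedAddCommGroup E] [NormedSpace ℝ E] (s : Finset ι)
    {c : ι → ℝ → E → ℝ} (h : ∀ i ∈ s, IsDeltaSymbol 0 (c i)) :
    IsDeltaSymbol 0 (fun δ x => ∏ i ∈ s, c i δ x) := by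
  classical
  induction s using Finset.induction_on with
  | empty => simpa using IsDeltaSymbol.const (E := E) 1
  | insert a s ha ih =>
    have hmul := (h a (Finset.mem_insert_self a s)).mul (ih fun i hi => h i (Finset.mem_insert_of_mem hi))
    refine isDeltaSymbol_congr hmul fun δ _ _ => ?_
    funext x
    rw [Finset.prod_insert ha]

/-- Finite products of local functions are local. [folklore] -/
theorem dependsOn_prod {ι : Type*} {S : Set (Fin m)} (s : Finset ι) {g : ι → (Fin m → ℝ) → ℝ}
    (h : ∀ i ∈ s, DependsOn (g i) S) : DependsOn (fun w => ∏ i ∈ s, g i w) S :=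
  fun _ _ hw => Finset.prod_congr rfl fun i hi => h i hi hw

/-- Finite sums of local functions are local. [folklore] -/
theorem dependsOn_sum {ι : Type*} {S : Set (Fin m)} (s : Finset ι) {g : ι → (Fin m → ℝ) → ℝ}
    (h : ∀ i ∈ s, DependsOn (g i) S) : DependsOn (fun w => ∑ i ∈ s, g i w) S :=
  fun _ _ hw => Finset.sum_congr rfl fun i hi => h i hi hw

/-- Quotients of local functions are local. [folklore] -/
theorem _root_.DependsOn.div' {S : Set (Fin m)} {g g' : (Fin m → ℝ) → ℝ} (hg : DependsOn g S) (hg' : DependsOn g' S) :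
    DependsOn (fun w => g w / g' w) S := fun _ _ hw => by simp only [hg hw, hg' hw]

/-- The union bound `1 - ∏(1 - θ_y) ≤ ∑ θ_y` for `θ_y ∈ [0, 1]`. [folklore] -/
theorem one_sub_prod_le_sum {ι : Type*} (s : Finset ι) {f : ι → ℝ} (h0 : ∀ i ∈ s, 0 ≤ f i) (h1 : ∀ i ∈ s, f i ≤ 1) :
    1 - ∏ i ∈ s, (1 - f i) ≤ ∑ i ∈ s, f i := by
  classical
  induction s using Finset.induction_on with
  | empty => simp
  | insert a s ha ih =>
    rw [Finset.prod_insert ha, Finset.sum_insert ha]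
    have h0' := fun i hi => h0 i (Finset.mem_insert_of_mem hi)
    have h1' := fun i hi => h1 i (Finset.mem_insert_of_mem hi)
    have hP1 : ∏ i ∈ s, (1 - f i) ≤ 1 := Finset.prod_le_one (fun i hi => by linarith [h1' i hi]) fun i hi => by linarith [h0' i hi]
    have hP0 : 0 ≤ ∏ i ∈ s, (1 - f i) := Finset.prod_nonneg fun i hi => by linarith [h1' i hi]
    have ha0 := h0 a (Finset.mem_insert_self a s)
    nlinarith [ih h0' h1']

/-! ### The partition `ϑ_{a,x}`, `ϑ_*` of §5.1 -/

section Partition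

variable {r L n₂ : ℕ} (Θ : ResonanceCutoffs m r L n₂) (b : Fin m) (n₃ : ℕ)

/-- `B(a, n₃)` inside the window. [cite: DeRoeckHuveneers2015, §5.1 (definition of `ϑ_{a,x}`, `ϑ_{a,*}`)] -/
def nearSites (b : Fin m) (n₃ : ℕ) : Finset (Fin m) := Finset.univ.filter fun x => Nat.dist b.val x.val ≤ n₃

/-- Membership in `B(a, n₃)`. [folklore] -/
@[simp] theorem mem_nearSites {b x : Fin m} {n₃ : ℕ} : x ∈ nearSites b n₃ ↔ Nat.dist b.val x.val ≤ n₃ := by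
  simp [nearSites]

/-- `a ∈ B(a, n₃)`. [folklore] -/
theorem self_mem_nearSites (b : Fin m) (n₃ : ℕ) : b ∈ nearSites b n₃ := by simp [Nat.dist_self]

/-- `∏_{y ∈ B(a,n₃)} θ_y`. [cite: DeRoeckHuveneers2015, §5.1 (definition of `ϑ_{a,x}`, `ϑ_{a,*}`)] -/
def piTheta (δ : ℝ) (w : Fin m → ℝ) : ℝ := ∏ y ∈ nearSites b n₃, Θ.θ y δ w

/-- `∏_{y ∈ B(a,n₃)} (1 - θ_y)`. [cite: DeRoeckHuveneers2015, §5.1 (definition of `ϑ_{a,x}`, `ϑ_{a,*}`)] -/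
def piCompl (δ : ℝ) (w : Fin m → ℝ) : ℝ := ∏ y ∈ nearSites b n₃, (1 - Θ.θ y δ w)

/-- The normalisation `𝒩 = ∏θ + (1 - ∏θ)∑θ + ∏(1 - θ)`. [cite: DeRoeckHuveneers2015, §5.1 (definition of `ϑ_{a,x}`, `ϑ_{a,*}`)] -/
def nrm (δ : ℝ) (w : Fin m → ℝ) : ℝ :=
  piTheta Θ b n₃ δ w + (1 - piTheta Θ b n₃ δ w) * ∑ x ∈ nearSites b n₃, Θ.θ x δ w + piCompl Θ b n₃ δ w

/-- The numerator of `ϑ_{a,x}`: `∏θ · [x = a] + (1 - ∏θ) θ_x`. [cite: DeRoeckHuveneers2015, §5.1 (definition of `ϑ_{a,x}`, `ϑ_{a,*}`)] -/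
def vtNum (x : Fin m) (δ : ℝ) (w : Fin m → ℝ) : ℝ :=
  piTheta Θ b n₃ δ w * (if x = b then 1 else 0) + (1 - piTheta Θ b n₃ δ w) * Θ.θ x δ w

/-- **`ϑ_{a,x}`** (for `x ∈ B(a, n₃)`). [cite: DeRoeckHuveneers2015, §5.1 (definition of `ϑ_{a,x}`, `ϑ_{a,*}`)] -/
def vt (x : Fin m) (δ : ℝ) (w : Fin m → ℝ) : ℝ := vtNum Θ b n₃ x δ w / nrm Θ b n₃ δ w

/-- **`ϑ_*`**. [cite: DeRoeckHuveneers2015, §5.1 (definition of `ϑ_{a,x}`, `ϑ_{a,*}`)] -/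
def vtStar (δ : ℝ) (w : Fin m → ℝ) : ℝ := piCompl Θ b n₃ δ w / nrm Θ b n₃ δ w

variable {Θ b n₃}

/-- `0 ≤ ∏θ`. [cite: DeRoeckHuveneers2015, §5.1 (definition of `ϑ_{a,x}`, `ϑ_{a,*}`)] -/
theorem piTheta_nonneg (δ : ℝ) (w : Fin m → ℝ) : 0 ≤ piTheta Θ b n₃ δ w :=
  Finset.prod_nonneg fun y _ => Θ.nonneg y δ w

/-- `∏θ ≤ 1`. [cite: DeRoeckHuveneers2015, §5.1 (definition of `ϑ_{a,x}`, `ϑ_{a,*}`)] -/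
theorem piTheta_le_one (δ : ℝ) (w : Fin m → ℝ) : piTheta Θ b n₃ δ w ≤ 1 :=
  Finset.prod_le_one (fun y _ => Θ.nonneg y δ w) fun y _ => Θ.le_one y δ w

/-- `0 ≤ ∏(1-θ)`. [cite: DeRoeckHuveneers2015, §5.1 (definition of `ϑ_{a,x}`, `ϑ_{a,*}`)] -/
theorem piCompl_nonneg (δ : ℝ) (w : Fin m → ℝ) : 0 ≤ piCompl Θ b n₃ δ w :=
  Finset.prod_nonneg fun y _ => by linarith [Θ.le_one y δ w]

/-- `∏(1-θ) ≤ 1`. [cite: DeRoeckHuveneers2015, §5.1 (definition of `ϑ_{a,x}`, `ϑ_{a,*}`)] -/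
theorem piCompl_le_one (δ : ℝ) (w : Fin m → ℝ) : piCompl Θ b n₃ δ w ≤ 1 :=
  Finset.prod_le_one (fun y _ => by linarith [Θ.le_one y δ w]) fun y _ => by linarith [Θ.nonneg y δ w]

/-- **`𝒩 ≥ 1`.** [cite: DeRoeckHuveneers2015, §5.1 ("satisfying `𝒩 ≥ 1`")] -/
theorem one_le_nrm (δ : ℝ) (w : Fin m → ℝ) : 1 ≤ nrm Θ b n₃ δ w := by
  unfold nrm
  have hU := one_sub_prod_le_sum (nearSites b n₃) (f := fun y => Θ.θ y δ w) (fun y _ => Θ.nonneg y δ w)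
    fun y _ => Θ.le_one y δ w
  have hP0 := piTheta_nonneg (Θ := Θ) (b := b) (n₃ := n₃) δ w
  have hP1 := piTheta_le_one (Θ := Θ) (b := b) (n₃ := n₃) δ w
  have hC0 := piCompl_nonneg (Θ := Θ) (b := b) (n₃ := n₃) δ w
  change 1 ≤ piTheta Θ b n₃ δ w + (1 - piTheta Θ b n₃ δ w) * ∑ x ∈ nearSites b n₃, Θ.θ x δ w + piCompl Θ b n₃ δ w
  unfold piCompl at hC0 ⊢
  nlinarith

/-- `𝒩 > 0`. [cite: DeRoeckHuveneers2015, §5.1] -/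
theorem nrm_pos (δ : ℝ) (w : Fin m → ℝ) : 0 < nrm Θ b n₃ δ w := lt_of_lt_of_le one_pos (one_le_nrm δ w)

/-- `𝒩 ≠ 0`. [cite: DeRoeckHuveneers2015, §5.1] -/
theorem nrm_ne_zero (δ : ℝ) (w : Fin m → ℝ) : nrm Θ b n₃ δ w ≠ 0 := (nrm_pos δ w).ne'

/-- The numerators are nonnegative. [cite: DeRoeckHuveneers2015, §5.1 (definition of `ϑ_{a,x}`, `ϑ_{a,*}`)] -/
theorem vtNum_nonneg (x : Fin m) (δ : ℝ) (w : Fin m → ℝ) : 0 ≤ vtNum Θ b n₃ x δ w := by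
  unfold vtNum
  have := piTheta_nonneg (Θ := Θ) (b := b) (n₃ := n₃) δ w
  have := piTheta_le_one (Θ := Θ) (b := b) (n₃ := n₃) δ w
  have := Θ.nonneg x δ w
  split_ifs <;> nlinarith

/-- The numerators sum to `𝒩`. [cite: DeRoeckHuveneers2015, §5.1] -/
theorem sum_vtNum_add_piCompl (δ : ℝ) (w : Fin m → ℝ) :
    ∑ x ∈ nearSites b n₃, vtNum Θ b n₃ x δ w + piCompl Θ b n₃ δ w = nrm Θ b n₃ δ w := by
  unfold vtNum nrm
  rw [Finset.sum_add_distrib, ← Finset.mul_sum, ← Finset.mul_sum, Finset.sum_ite_eq' (nearSites b n₃) b,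
    if_pos (self_mem_nearSites b n₃), mul_one]

/-- **Partition of unity: `∑_{x ∈ B(a,n₃)} ϑ_{a,x} + ϑ_* = 1`.** [cite: DeRoeckHuveneers2015, §5.1 ("chosen so that `∑_{x∈B(a,n₃)} ϑ_{a,x} + ϑ_{a,*} = 1`")] -/
theorem sum_vt_add_vtStar (δ : ℝ) (w : Fin m → ℝ) :
    ∑ x ∈ nearSites b n₃, vt Θ b n₃ x δ w + vtStar Θ b n₃ δ w = 1 := by
  unfold vt vtStar
  rw [← Finset.sum_div, ← add_div, sum_vtNum_add_piCompl, div_self (nrm_ne_zero δ w)]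

/-- `0 ≤ ϑ_{a,x}`. [cite: DeRoeckHuveneers2015, §5.1 (definition of `ϑ_{a,x}`, `ϑ_{a,*}`)] -/
theorem vt_nonneg (x : Fin m) (δ : ℝ) (w : Fin m → ℝ) : 0 ≤ vt Θ b n₃ x δ w :=
  div_nonneg (vtNum_nonneg x δ w) (nrm_pos δ w).le

/-- `0 ≤ ϑ_*`. [cite: DeRoeckHuveneers2015, §5.1 (definition of `ϑ_{a,x}`, `ϑ_{a,*}`)] -/
theorem vtStar_nonneg (δ : ℝ) (w : Fin m → ℝ) : 0 ≤ vtStar Θ b n₃ δ w :=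
  div_nonneg (piCompl_nonneg δ w) (nrm_pos δ w).le

/-- `ϑ_{a,x} ≤ 1`. [cite: DeRoeckHuveneers2015, §5.1] -/
theorem vt_le_one {x : Fin m} (hx : x ∈ nearSites b n₃) (δ : ℝ) (w : Fin m → ℝ) : vt Θ b n₃ x δ w ≤ 1 := by
  have h := sum_vt_add_vtStar (Θ := Θ) (b := b) (n₃ := n₃) δ w
  have h1 : vt Θ b n₃ x δ w ≤ ∑ x ∈ nearSites b n₃, vt Θ b n₃ x δ w :=
    Finset.single_le_sum (fun y _ => vt_nonneg y δ w) hx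
  linarith [vtStar_nonneg (Θ := Θ) (b := b) (n₃ := n₃) δ w]

/-- `ϑ_* ≤ 1`. [cite: DeRoeckHuveneers2015, §5.1] -/
theorem vtStar_le_one (δ : ℝ) (w : Fin m → ℝ) : vtStar Θ b n₃ δ w ≤ 1 := by
  have h := sum_vt_add_vtStar (Θ := Θ) (b := b) (n₃ := n₃) δ w
  have : 0 ≤ ∑ x ∈ nearSites b n₃, vt Θ b n₃ x δ w := Finset.sum_nonneg fun y _ => vt_nonneg y δ w
  linarith

/-! #### Smoothness, classes, locality -/

/-- `∏θ` is a symbol of order `0`. [cite: DeRoeckHuveneers2015, §5.6 ("`∂ϑ_{a,x}, ∂ϑ_{a,*} ∼ δ^{-1}`")] -/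
theorem isDeltaSymbol_piTheta : IsDeltaSymbol 0 (piTheta Θ b n₃) :=
  isDeltaSymbol_prod _ fun y _ => Θ.symbol y

/-- `∏(1 - θ)` is a symbol of order `0`. [cite: DeRoeckHuveneers2015, §5.6 ("`∂ϑ_{a,x}, ∂ϑ_{a,*} ∼ δ^{-1}`")] -/
theorem isDeltaSymbol_piCompl : IsDeltaSymbol 0 (piCompl Θ b n₃) :=
  isDeltaSymbol_prod _ fun y _ => by
    have := (IsDeltaSymbol.const (E := Fin m → ℝ) 1).sub (Θ.symbol y)
    exact isDeltaSymbol_congr this fun δ _ _ => rfl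

/-- `𝒩` is a symbol of order `0`. [cite: DeRoeckHuveneers2015, §5.6 ("`∂ϑ_{a,x}, ∂ϑ_{a,*} ∼ δ^{-1}`")] -/
theorem isDeltaSymbol_nrm : IsDeltaSymbol 0 (nrm Θ b n₃) := by
  have hP := isDeltaSymbol_piTheta (Θ := Θ) (b := b) (n₃ := n₃)
  have hS : IsDeltaSymbol 0 (fun δ w => ∑ x ∈ nearSites b n₃, Θ.θ x δ w) := IsDeltaSymbol.sum _ fun y _ => Θ.symbol y
  have h1P : IsDeltaSymbol 0 (fun δ w => 1 - piTheta Θ b n₃ δ w) := (IsDeltaSymbol.const (E := Fin m → ℝ) 1).sub hP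
  have := (hP.add ((h1P.mul hS).mono (le_of_eq (Nat.zero_add 0)))).add (isDeltaSymbol_piCompl (Θ := Θ) (b := b) (n₃ := n₃))
  exact isDeltaSymbol_congr this fun δ _ _ => rfl

/-- `𝒩⁻¹` is a symbol of order `0` (as `𝒩 ≥ 1`). [cite: DeRoeckHuveneers2015, §5.1 (`𝒩 ≥ 1`) and §5.6] -/
theorem isDeltaSymbol_nrm_inv : IsDeltaSymbol 0 (fun δ w => (nrm Θ b n₃ δ w)⁻¹) :=
  isDeltaSymbol_inv isDeltaSymbol_nrm fun δ _ _ w => one_le_nrm δ w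

/-- The numerators are symbols of order `0`. [cite: DeRoeckHuveneers2015, §5.6 ("`∂ϑ_{a,x}, ∂ϑ_{a,*} ∼ δ^{-1}`")] -/
theorem isDeltaSymbol_vtNum (x : Fin m) : IsDeltaSymbol 0 (vtNum Θ b n₃ x) := by
  have hP := isDeltaSymbol_piTheta (Θ := Θ) (b := b) (n₃ := n₃)
  have h1P : IsDeltaSymbol 0 (fun δ w => 1 - piTheta Θ b n₃ δ w) := (IsDeltaSymbol.const (E := Fin m → ℝ) 1).sub hP
  have := ((hP.mul (IsDeltaSymbol.const (E := Fin m → ℝ) (if x = b then (1 : ℝ) else 0))).mono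
    (le_of_eq (Nat.zero_add 0))).add ((h1P.mul (Θ.symbol x)).mono (le_of_eq (Nat.zero_add 0)))
  exact isDeltaSymbol_congr this fun δ _ _ => rfl

/-- **`ϑ_{a,x}` is a symbol of order `0`.** [cite: DeRoeckHuveneers2015, §5.6 ("since `∂_♯ ϑ_{a,x}, ∂_♯ ϑ_{a,*} ∼ δ^{-1}`")] -/
theorem isDeltaSymbol_vt (x : Fin m) : IsDeltaSymbol 0 (vt Θ b n₃ x) := by
  have := ((isDeltaSymbol_vtNum (Θ := Θ) (b := b) (n₃ := n₃) x).mul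
    (isDeltaSymbol_nrm_inv (Θ := Θ) (b := b) (n₃ := n₃))).mono (le_of_eq (Nat.zero_add 0))
  exact isDeltaSymbol_congr this fun δ _ _ => by funext w; simp [vt, div_eq_mul_inv]

/-- **`ϑ_*` is a symbol of order `0`.** [cite: DeRoeckHuveneers2015, §5.6 ("since `∂_♯ ϑ_{a,x}, ∂_♯ ϑ_{a,*} ∼ δ^{-1}`")] -/
theorem isDeltaSymbol_vtStar : IsDeltaSymbol 0 (vtStar Θ b n₃) := by
  have := ((isDeltaSymbol_piCompl (Θ := Θ) (b := b) (n₃ := n₃)).mul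
    (isDeltaSymbol_nrm_inv (Θ := Θ) (b := b) (n₃ := n₃))).mono (le_of_eq (Nat.zero_add 0))
  exact isDeltaSymbol_congr this fun δ _ _ => by funext w; simp [vtStar, div_eq_mul_inv]

/-- `ϑ_{a,x}` is smooth at every scale `δ ∈ (0, 1]`. [cite: DeRoeckHuveneers2015, §5.1] -/
theorem contDiff_vt {δ : ℝ} (hδ : 0 < δ) (hδ1 : δ ≤ 1) (x : Fin m) : ContDiff ℝ ∞ (vt Θ b n₃ x δ) :=
  (isDeltaSymbol_vt x).contDiff hδ hδ1

/-- `ϑ_*` is smooth at every scale `δ ∈ (0, 1]`. [cite: DeRoeckHuveneers2015, §5.1] -/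
theorem contDiff_vtStar {δ : ℝ} (hδ : 0 < δ) (hδ1 : δ ≤ 1) : ContDiff ℝ ∞ (vtStar Θ b n₃ δ) :=
  isDeltaSymbol_vtStar.contDiff hδ hδ1

/-- The ball on which the partition depends: `B(a, n₃ + Rθ)`. [cite: DeRoeckHuveneers2015, §5.3 ("only depend on variables indexed by `z` with `z ≥ a - (n₃ + 4r + n₂ r)`")] -/
theorem dependsOn_theta_near {x : Fin m} (hx : x ∈ nearSites b n₃) (δ : ℝ) :
    DependsOn (Θ.θ x δ) (siteBall b (n₃ + Θ.Rθ)) :=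
  (Θ.dependsOn x δ).mono (TrigTerm.siteBall_anchor (by rw [Nat.dist_comm]; exact mem_nearSites.1 hx))

/-- `ϑ_{a,x}` depends on `ω` only in `B(a, n₃ + Rθ)` (`x ∈ B(a, n₃)`). [cite: DeRoeckHuveneers2015, §5.3] -/
theorem dependsOn_vt {x : Fin m} (hx : x ∈ nearSites b n₃) (δ : ℝ) :
    DependsOn (vt Θ b n₃ x δ) (siteBall b (n₃ + Θ.Rθ)) := by
  have hP : DependsOn (piTheta Θ b n₃ δ) (siteBall b (n₃ + Θ.Rθ)) :=
    dependsOn_prod _ fun y hy => dependsOn_theta_near hy δ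
  have hC : DependsOn (piCompl Θ b n₃ δ) (siteBall b (n₃ + Θ.Rθ)) :=
    dependsOn_prod _ fun y hy => (dependsOn_const' _ 1).sub (dependsOn_theta_near hy δ)
  have hS : DependsOn (fun w => ∑ x ∈ nearSites b n₃, Θ.θ x δ w) (siteBall b (n₃ + Θ.Rθ)) :=
    dependsOn_sum _ fun y hy => dependsOn_theta_near hy δ
  have hN : DependsOn (nrm Θ b n₃ δ) (siteBall b (n₃ + Θ.Rθ)) :=
    (hP.add (((dependsOn_const' _ 1).sub hP).mul hS)).add hC
  exact ((hP.mul (dependsOn_const' _ _)).add (((dependsOn_const' _ 1).sub hP).mul (dependsOn_theta_near hx δ))).div' hN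

/-- `ϑ_*` depends on `ω` only in `B(a, n₃ + Rθ)`. [cite: DeRoeckHuveneers2015, §5.3] -/
theorem dependsOn_vtStar (δ : ℝ) : DependsOn (vtStar Θ b n₃ δ) (siteBall b (n₃ + Θ.Rθ)) := by
  have hP : DependsOn (piTheta Θ b n₃ δ) (siteBall b (n₃ + Θ.Rθ)) :=
    dependsOn_prod _ fun y hy => dependsOn_theta_near hy δ
  have hC : DependsOn (piCompl Θ b n₃ δ) (siteBall b (n₃ + Θ.Rθ)) :=
    dependsOn_prod _ fun y hy => (dependsOn_const' _ 1).sub (dependsOn_theta_near hy δ)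
  have hS : DependsOn (fun w => ∑ x ∈ nearSites b n₃, Θ.θ x δ w) (siteBall b (n₃ + Θ.Rθ)) :=
    dependsOn_sum _ fun y hy => dependsOn_theta_near hy δ
  exact hC.div' ((hP.add (((dependsOn_const' _ 1).sub hP).mul hS)).add hC)

/-! #### Qualitative properties used in §5.4–5.6 -/

/-- **`ϑ_{a,x}(ω) ≠ 0 ⇒ θ_x(ω) > 0`** (`x ∈ B(a, n₃)`). [cite: DeRoeckHuveneers2015, §5.4 ("Let us thus take `ω` such that `ϑ_{a,x}(ω) > 0`, which implies `θ_x(ω) > 0`")] -/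
theorem theta_pos_of_vt_ne_zero {x : Fin m} (hx : x ∈ nearSites b n₃) {δ : ℝ} {w : Fin m → ℝ}
    (h : vt Θ b n₃ x δ w ≠ 0) : 0 < Θ.θ x δ w := by
  rcases (Θ.nonneg x δ w).lt_or_eq with hpos | h0
  · exact hpos
  · exfalso; apply h
    unfold vt vtNum
    have hP : piTheta Θ b n₃ δ w * (if x = b then 1 else 0) = 0 := by
      by_cases hxb : x = b
      · subst hxb
        rw [if_pos rfl, mul_one]
        exact Finset.prod_eq_zero hx h0.symm
      · rw [if_neg hxb, mul_zero]
    rw [hP, ← h0, mul_zero, add_zero, zero_div]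

/-- **`ϑ_*(ω) ≠ 0 ⇒ θ_y(ω) < 1` for all `y ∈ B(a, n₃)`.** [cite: DeRoeckHuveneers2015, §5.5 proof of Lemma 4 ("If `∏_{x∈B(a,n₃)}(1 - θ_x) ≠ 0`, then `θ_x(ω) < 1` for all `x ∈ B(a,n₃)`")] -/
theorem theta_lt_one_of_vtStar_ne_zero {δ : ℝ} {w : Fin m → ℝ} (h : vtStar Θ b n₃ δ w ≠ 0) {y : Fin m}
    (hy : y ∈ nearSites b n₃) : Θ.θ y δ w < 1 := by
  rcases (Θ.le_one y δ w).lt_or_eq with hlt | h1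
  · exact hlt
  · exfalso; apply h
    unfold vtStar piCompl
    rw [Finset.prod_eq_zero hy (by rw [h1, sub_self]), zero_div]

/-- On the good set `{θ_y = 1 ∀ y ∈ B(a,n₃)}` (the complement of `W`): `∏θ = 1`. [cite: DeRoeckHuveneers2015, §5.6 (definition of `W`)] -/
theorem piTheta_eq_one_of_good {δ : ℝ} {w : Fin m → ℝ} (h : ∀ y ∈ nearSites b n₃, Θ.θ y δ w = 1) :
    piTheta Θ b n₃ δ w = 1 := Finset.prod_eq_one h

/-- On the good set: `ϑ_{a,x} = [x = a]`. [cite: DeRoeckHuveneers2015, §5.6 ("`ϑ_{a,x}(ω) = δ_{a,x}` … for `(ω,q) ∈ Ω ∖ W`", "By inspection of the definitions")] -/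
theorem vt_of_good {δ : ℝ} {w : Fin m → ℝ} (h : ∀ y ∈ nearSites b n₃, Θ.θ y δ w = 1) (x : Fin m) :
    vt Θ b n₃ x δ w = if x = b then 1 else 0 := by
  have hN : nrm Θ b n₃ δ w = 1 := by
    have := sum_vtNum_add_piCompl (Θ := Θ) (b := b) (n₃ := n₃) δ w
    unfold vtNum piCompl at this
    rw [piTheta_eq_one_of_good h] at this
    simp only [one_mul, sub_self, zero_mul, add_zero, Finset.sum_ite_eq', if_pos (self_mem_nearSites b n₃)] at this
    rw [Finset.prod_eq_zero (self_mem_nearSites b n₃) (by rw [h b (self_mem_nearSites b n₃), sub_self])] at this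
    linarith
  unfold vt vtNum
  rw [hN, div_one, piTheta_eq_one_of_good h]
  simp

/-- On the good set: `ϑ_* = 0`. [cite: DeRoeckHuveneers2015, §5.6 ("`ϑ_{a,*}(ω) = 0` … for `(ω,q) ∈ Ω ∖ W`")] -/
theorem vtStar_of_good {δ : ℝ} {w : Fin m → ℝ} (h : ∀ y ∈ nearSites b n₃, Θ.θ y δ w = 1) :
    vtStar Θ b n₃ δ w = 0 := by
  unfold vtStar piCompl
  rw [Finset.prod_eq_zero (self_mem_nearSites b n₃) (by rw [h b (self_mem_nearSites b n₃), sub_self]), zero_div]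

/-- **On the good set all gradients of the partition vanish** (`ϑ_{a,a}` has a maximum there, the
other `ϑ`'s minima); the source's form of this is §5.5, proof of Lemma 4 ("since `L_H̃` is a
differential operator"). [cite: DeRoeckHuveneers2015, §5.5 proof of Lemma 4 and §5.6 (definition of `W`)] -/
theorem fderiv_vt_of_good {δ : ℝ} {w : Fin m → ℝ}
    (h : ∀ y ∈ nearSites b n₃, Θ.θ y δ w = 1) {x : Fin m} (hx : x ∈ nearSites b n₃) :
    fderiv ℝ (vt Θ b n₃ x δ) w = 0 := by
  by_cases hxb : x = b
  · refine IsLocalMax.fderiv_eq_zero ?_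
    filter_upwards with w'
    rw [vt_of_good h, if_pos hxb]
    exact vt_le_one hx δ w'
  · refine IsLocalMin.fderiv_eq_zero ?_
    filter_upwards with w'
    rw [vt_of_good h, if_neg hxb]
    exact vt_nonneg x δ w'

/-- On the good set the gradient of `ϑ_*` vanishes (a minimum). [cite: DeRoeckHuveneers2015, §5.5 proof of Lemma 4 ("since `L_H̃` is a differential operator")] -/
theorem fderiv_vtStar_of_good {δ : ℝ} {w : Fin m → ℝ} (h : ∀ y ∈ nearSites b n₃, Θ.θ y δ w = 1) :
    fderiv ℝ (vtStar Θ b n₃ δ) w = 0 := by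
  refine IsLocalMin.fderiv_eq_zero ?_
  filter_upwards with w'
  rw [vtStar_of_good h]
  exact vtStar_nonneg δ w'

/-! #### Directional derivatives of the partition come from those of the `θ`'s -/

/-- If every `θ_y`, `y ∈ B(a,n₃)`, has zero derivative at `ω` in the direction `v`, so has any
product `∏_{y ∈ s} g_y(θ_y)` with `s ⊆ B(a,n₃)`-indexed smooth factors — here for the two products and
the sum entering `ϑ`. [folklore] -/
theorem hasDerivAt_line_prod {δ : ℝ} (hδ : 0 < δ) (hδ1 : δ ≤ 1) {w v : Fin m → ℝ}
    (hv : ∀ y ∈ nearSites b n₃, fderiv ℝ (Θ.θ y δ) w v = 0) (φ : ℝ → ℝ) (hφ : Differentiable ℝ φ) :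
    HasDerivAt (fun s : ℝ => ∏ y ∈ nearSites b n₃, φ (Θ.θ y δ (w + s • v))) 0 0 := by
  have hline : ∀ y ∈ nearSites b n₃, HasDerivAt (fun s : ℝ => φ (Θ.θ y δ (w + s • v))) 0 0 := by
    intro y hy
    have h1 : HasDerivAt (fun s : ℝ => w + s • v) v 0 := by
      simpa using ((hasDerivAt_id (0 : ℝ)).smul_const v).const_add w
    have h2 : HasFDerivAt (Θ.θ y δ) (fderiv ℝ (Θ.θ y δ) w) (w + (0 : ℝ) • v) := by
      rw [zero_smul, add_zero]
      exact (((Θ.contDiff hδ hδ1 y).differentiable (by simp)) w).hasFDerivAt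
    have h3 := h2.comp_hasDerivAt (0 : ℝ) h1
    rw [hv y hy] at h3
    have h4 := (((hφ _).hasDerivAt).comp (0 : ℝ) h3).congr_deriv (g' := 0) (by simp)
    exact h4
  have h := HasDerivAt.fun_finsetProd (u := nearSites b n₃) (f := fun y (s : ℝ) => φ (Θ.θ y δ (w + s • v)))
    (f' := fun _ => (0 : ℝ)) (x := 0) hline
  refine h.congr_deriv ?_
  simp

/-- A single `θ_y` along the line `s ↦ ω + s v` has derivative `0` at `s = 0` when `∂_v θ_y(ω) = 0`.
[folklore] -/
theorem hasDerivAt_line_theta {δ : ℝ} (hδ : 0 < δ) (hδ1 : δ ≤ 1) {w v : Fin m → ℝ} (y : Fin m)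
    (hv : fderiv ℝ (Θ.θ y δ) w v = 0) : HasDerivAt (fun s : ℝ => Θ.θ y δ (w + s • v)) 0 0 := by
  have h1 : HasDerivAt (fun s : ℝ => w + s • v) v 0 := by
    simpa using ((hasDerivAt_id (0 : ℝ)).smul_const v).const_add w
  have h2 : HasFDerivAt (Θ.θ y δ) (fderiv ℝ (Θ.θ y δ) w) (w + (0 : ℝ) • v) := by
    rw [zero_smul, add_zero]
    exact (((Θ.contDiff hδ hδ1 y).differentiable (by simp)) w).hasFDerivAt
  have h3 := h2.comp_hasDerivAt (0 : ℝ) h1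
  rw [hv] at h3
  exact h3

/-- The sum `∑_y θ_y` along the line has derivative `0`. [folklore] -/
theorem hasDerivAt_line_sum {δ : ℝ} (hδ : 0 < δ) (hδ1 : δ ≤ 1) {w v : Fin m → ℝ}
    (hv : ∀ y ∈ nearSites b n₃, fderiv ℝ (Θ.θ y δ) w v = 0) :
    HasDerivAt (fun s : ℝ => ∑ y ∈ nearSites b n₃, Θ.θ y δ (w + s • v)) 0 0 := by
  have h := HasDerivAt.fun_sum (u := nearSites b n₃) (A := fun y (s : ℝ) => Θ.θ y δ (w + s • v)) (A' := fun _ => (0 : ℝ))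
    (x := 0) fun y hy => hasDerivAt_line_theta hδ hδ1 y (hv y hy)
  refine h.congr_deriv ?_
  simp

/-- `𝒩` along the line has derivative `0`. [folklore] -/
theorem hasDerivAt_line_nrm {δ : ℝ} (hδ : 0 < δ) (hδ1 : δ ≤ 1) {w v : Fin m → ℝ}
    (hv : ∀ y ∈ nearSites b n₃, fderiv ℝ (Θ.θ y δ) w v = 0) :
    HasDerivAt (fun s : ℝ => nrm Θ b n₃ δ (w + s • v)) 0 0 := by
  have hP := hasDerivAt_line_prod hδ hδ1 hv id differentiable_id
  have hC := hasDerivAt_line_prod hδ hδ1 hv (fun t => 1 - t) ((differentiable_const 1).sub differentiable_id)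
  have hS := hasDerivAt_line_sum hδ hδ1 hv
  have h := (hP.add (((hasDerivAt_const (0 : ℝ) (1 : ℝ)).sub hP).mul hS)).add hC
  have h0 := h.congr_deriv (g' := 0) (by simp)
  exact h0

/-- The numerator of `ϑ_{a,x}` along the line has derivative `0` (`x ∈ B(a, n₃)`). [folklore] -/
theorem hasDerivAt_line_vtNum {δ : ℝ} (hδ : 0 < δ) (hδ1 : δ ≤ 1) {w v : Fin m → ℝ}
    (hv : ∀ y ∈ nearSites b n₃, fderiv ℝ (Θ.θ y δ) w v = 0) {x : Fin m} (hx : x ∈ nearSites b n₃) :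
    HasDerivAt (fun s : ℝ => vtNum Θ b n₃ x δ (w + s • v)) 0 0 := by
  have hP := hasDerivAt_line_prod hδ hδ1 hv id differentiable_id
  have hθx := hasDerivAt_line_theta hδ hδ1 x (hv x hx)
  have h := (hP.mul_const (if x = b then (1 : ℝ) else 0)).add (((hasDerivAt_const (0 : ℝ) (1 : ℝ)).sub hP).mul hθx)
  have h0 := h.congr_deriv (g' := 0) (by simp)
  exact h0

/-- **Directional derivatives of `ϑ_{a,x}` vanish where those of all `θ_y` do** (`x ∈ B(a,n₃)`):
`∂_v ϑ_{a,x}(ω) = ∑_y (∂ϑ/∂θ_y) ∂_v θ_y(ω)`. [cite: DeRoeckHuveneers2015, §5.5 proof of Lemma 4 ("the condition `L_H̃ H̃_{>a}(ω,q) ≠ 0` implies actually `∏(1 - θ_x) ≠ 0` or `L_H̃ θ_x(ω,q) ≠ 0` for some `x ∈ B(a,n₃)`")] -/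
theorem fderiv_vt_apply_eq_zero {δ : ℝ} (hδ : 0 < δ) (hδ1 : δ ≤ 1) {w v : Fin m → ℝ}
    (hv : ∀ y ∈ nearSites b n₃, fderiv ℝ (Θ.θ y δ) w v = 0) {x : Fin m} (hx : x ∈ nearSites b n₃) :
    fderiv ℝ (vt Θ b n₃ x δ) w v = 0 := by
  have hdiff : Differentiable ℝ (vt Θ b n₃ x δ) := (contDiff_vt hδ hδ1 x).differentiable (by simp)
  have hlv : HasDerivAt (fun s : ℝ => vt Θ b n₃ x δ (w + s • v)) (fderiv ℝ (vt Θ b n₃ x δ) w v) 0 := by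
    have h1 : HasDerivAt (fun s : ℝ => w + s • v) v 0 := by
      simpa using ((hasDerivAt_id (0 : ℝ)).smul_const v).const_add w
    have h2 : HasFDerivAt (vt Θ b n₃ x δ) (fderiv ℝ (vt Θ b n₃ x δ) w) (w + (0 : ℝ) • v) := by
      rw [zero_smul, add_zero]; exact (hdiff w).hasFDerivAt
    exact h2.comp_hasDerivAt (0 : ℝ) h1
  have hq := ((hasDerivAt_line_vtNum hδ hδ1 hv hx).div (hasDerivAt_line_nrm hδ hδ1 hv)
    (nrm_ne_zero δ (w + (0 : ℝ) • v))).congr_deriv (g' := 0) (by simp)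
  exact hlv.unique hq

/-- **Directional derivatives of `ϑ_*` vanish where those of all `θ_y` do.** [cite: DeRoeckHuveneers2015, §5.5 proof of Lemma 4] -/
theorem fderiv_vtStar_apply_eq_zero {δ : ℝ} (hδ : 0 < δ) (hδ1 : δ ≤ 1) {w v : Fin m → ℝ}
    (hv : ∀ y ∈ nearSites b n₃, fderiv ℝ (Θ.θ y δ) w v = 0) : fderiv ℝ (vtStar Θ b n₃ δ) w v = 0 := by
  have hdiff : Differentiable ℝ (vtStar Θ b n₃ δ) := (contDiff_vtStar hδ hδ1).differentiable (by simp)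
  have hlv : HasDerivAt (fun s : ℝ => vtStar Θ b n₃ δ (w + s • v)) (fderiv ℝ (vtStar Θ b n₃ δ) w v) 0 := by
    have h1 : HasDerivAt (fun s : ℝ => w + s • v) v 0 := by
      simpa using ((hasDerivAt_id (0 : ℝ)).smul_const v).const_add w
    have h2 : HasFDerivAt (vtStar Θ b n₃ δ) (fderiv ℝ (vtStar Θ b n₃ δ) w) (w + (0 : ℝ) • v) := by
      rw [zero_smul, add_zero]; exact (hdiff w).hasFDerivAt
    exact h2.comp_hasDerivAt (0 : ℝ) h1
  have hC := hasDerivAt_line_prod hδ hδ1 hv (fun t => 1 - t) ((differentiable_const 1).sub differentiable_id)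
  have hq := (hC.div (hasDerivAt_line_nrm hδ hδ1 hv) (nrm_ne_zero δ (w + (0 : ℝ) • v))).congr_deriv (g' := 0) (by simp)
  exact hlv.unique hq

end Partition

end Literature.Barriers.AtomisticToContinuum.HeatConduction.RotorChain

end
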